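import Literature.MathematicalPhysics.QuantumFieldTheory.Balaban1983to89.B9Eq3104CommutatorSupport
import Literature.MathematicalPhysics.QuantumFieldTheory.Balaban1983to89.B6IndexBondLayersKLevelV1

/-!
# `Balaban1983to89.B9Thm310CommutatorBound389B` — T. Bałaban, *Propagators for lattice gauge theories in a background field*,
# Commun. Math. Phys. **99** (1985) 389–434 [Balaban1985BackgroundPropagators], Sect. C p. 414: «The operator K(h_□)G_□h_□ satisfies the inequality (3.89),
# hence it is small» with (3.89) p. 409 «|(K(h_□)G′_□h_□λ)(x)| ≤ O(M⁻¹)e^{−δ₀(Lʲη)⁻¹|y−y′|}|λ| for x ∈ Δ(y), supp λ ⊂ Δ(y′), y, y′ ∈ □ ∈ 𝒟_j» and Thm 3.3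
# p. 399 (the (3.42) entries of the bond-sector propagator «with G′(U) replaced by G(U) and λ replaced by a function J defined at bonds»): THE POINTWISE
# (3.89)-TWIN FOR THE BOND SECTOR AT def-Y's LETTERS — `K(h_□)(U)(O(h_□Λ))` at a bond, for ANY bond cube letter `O` (= `G_□(U)`, r05's
# `B9CubeLettersBondOpsL0`) obeying the VALUE and GRADIENT entries of Thm 3.3 in the invariant-class reading, with the `O(M⁻¹)` EXPLICIT (sub-row G-B9-LETTERS,
# module M5.7-est, file E′₂b; E′₁ = `B9Eq3104CommutatorSizes` is the print-shape size, E′₂a = `B9Eq3104CommutatorSupport` the level window)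

statement-level skeleton of published theorems with citation tags; proofs where landed; nothing here is a claim about the Yang–Mills mass gap

PDF held: `paper:balaban1985-cmp99-background-propagators` (journal page = PDF page + 388); pp. 396–399, 409, 413–414 read from the text layer (`p0008`–`p0011`,
`p0021`, `p0025`–`p0026`); [4] = [Balaban1984PropagatorsII] (2.43)–(2.44) p. 230 (the U = 1 statement «|(K(h_□)G′(□)h_□λ)(x)| ≤ O(M⁻¹)e^{−δ₀|x−y|}|λ|»).

## THE DISPLAYED INPUTS (hypotheses, NOT asserted)
* (h342₀) VALUE and (h342₁) GRADIENT entries of the bond cube letter `O` at the configuration `U`, in p21's invariant-class reading made pointwise (the READ of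
  `B9FromB6.EBlock (B9CubeLettersInvReadings.kernelFamilyBInv …) B₀ δ U` at `n = 0, 1`, unbundled over the test class `‖Λ(x)‖ ≤ |J(x)|`): for `supp J ⊂ Δ(βy′)`,
  `x ∈ Δ(βy)`: `‖(OΛ)(x)‖ ≤ B₀·ℓ(y)²·e^{−δd(y,y′)}·|J|`, `‖(∇_{U,ν}OΛ)(x)‖ ≤ B₀·ℓ(y)·e^{−δd(y,y′)}·|J|` (`∇_{U,ν} = cdB`, physical units; `ℓ(y) = L^{j(y)}∕|c_f|`,
  `d = d_T` of the carrier blocks) — [B9] Thm 3.3 p. 399 with (3.42)₁,₂ p. 397.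
* E′₁'s class data at bi-contractive `U` and contour transporters `qT`: the plaquette holonomy defect `δ_P`, `ρ ≥ ‖Re U(∂p)‖`, the conjugation defect `δ_K` of the
  Jordan insertion, `δ_I ≥ ‖c_f²·Im U(∂p)‖` — all `0, ‖1‖, 0, 0` at `U = 1` — DISPLAYED, GLOBAL and level-free exactly as E′₁ takes them.
* `η = |c_f|⁻¹` (members of record: `B9Ineq349SiteFromBlocks.etaS_eq_abs_cf_inv`), a corner-free section `ιB` of `β` (as the whole Read342 dictionary), and the global
  weight band `w_y∕(c_f∕L^{j(y)})² ≤ b₁(L^{j(y)})^{d+1}` of the index (`KIdx.hwb`, [4] (2.16)).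

## WHAT THIS FILE PROVES (kernel-checked, 0 sorry; THEOREMS + one real constant `theta389B`; no `def … : Prop`, no new fact)
* §1 bookkeeping: the sup norm of a bond localisation, `|c_f| = L^k` from `η = |c_f|⁻¹`, the two-step geometry of the stencil, the weight band read as an upper
  bound, ★ `sum_abs_qsK_le` (`Σ_y|Q*(b,y)| ≤ 2·(L^{d+1})^{−lev b}`: the weights of one level are a sub-partition of unity, n06-i's `sum_qwt_lvl_le`, and only the
  levels `lev b`, `lev b + 1` see `b`).
* §2 `theta389B`, `arith389B` (the level bookkeeping as one real inequality), and ★★ `norm_KhBY_O_hTY_apply_le` — **THE BOND-SECTOR (3.89), POINTWISE**: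
  `‖(K(h_□)(U)·O(h_□Λ))(b)‖ ≤ θ₃₈₉ᴮ(d, L, B₀, b₁, δ, ρ, δ_P, δ_K, δ_I; j)∕(L·M_h) · e^{−δd(y,y′)} · |J|` for `b ∈ Δ(βy)`, `supp J ⊂ Δ(βy′)`, `‖Λ‖ ≤ |J|`, with
  `θ₃₈₉ᴮ = B₀·(e^{2δ}·((4ρ+1)(d+1)(2·(5∕8)C1F·L⁴ + (5∕8)²C2X·L⁸ + (5∕8)C1F·L⁸·δ_P·Lʲ) + (d+1)(5∕8)C1F·L⁶(4δ_K + 64δ_I)) + 4·sLipT(L+3)·b₁·L^{d+1}·e^{δ(2ℓ+6)})`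
  — print's «O(M⁻¹)», `M = L·M_h`: UNIFORM IN `j` in every term but the displayed holonomy defect, which enters as `δ_P·Lʲ`.
HONEST SCOPE ∕ DIVERGENCES.  (1) E′₁'s defect constants are GLOBAL: print's (3.35) p. 396 makes the plaquette field of a configuration of the class `O(1)Mα₀(Lʲη)⁻²·η²`
near a cube of index `j`, so that `δ_P·Lʲ` is small THERE — with a global `δ_P` this file keeps the honest factor `Lʲ` (zero at `U = 1`, where the statement is exactly
[4] (2.44) for bonds); the (3.35)-weighted form needs E′₁'s plaquette hypotheses localised to the star of `b` (successor file).  (2) The level window is `lev b ≤ j + 2`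
(E′₂a), the near entries cost `e^{2δ}`, the bond averagings `e^{δ(2ℓ+6)}` (their double blocks span `ℓ + 3` carrier blocks, [4] (2.45)).  (3) Same rate `δ` and same
distance `d(y,y′)` as the inputs.  (4) Corner-free members; `η = |c_f|⁻¹` a hypothesis.  (5) Nothing of Thm 3.10 ∕ 3.3 ∕ (3.42) is asserted (the entries are
HYPOTHESES, supplied by M5.1c ∕ M5.2-type modules); nothing continuum ∕ OS ∕ mass gap ∕ Clay; YM mass gap NOT proved by any of this (Track A conditional rung).
`--supports stmt-QuantumFields-19200`.  Net new unproved facts: 0.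
-/

noncomputable section

namespace Literature.MathematicalPhysics.QuantumFieldTheory.Balaban1983to89.B9Thm310CommutatorBound389B

open Node00
open B9Thm37CubeCoverCommutators (cutMulY cutMulY_apply hTY hTY_apply)
open B9Thm37CubeCoverCommutatorSizes (side_conditions)
open B9Thm37CubeCoverCommutatorSizesGrad (C1F_div_bigSide_eq)
open B9Thm37CommutatorBound389 (norm_cutMulY_le_of_le norm_cdsS_le_norm_cdS_shift lev_le_succ_of_touch torusSupNorm_sub_shiftY_le_one
  geo9K_dist_eq geo9K_len_eq levY_eq_lvl_of_blkOf_eq)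
open B9Eq3104CutoffCommutators (hBdY hBdY_apply KhBY)
open B9Eq3104CommutatorGradFormDD (cdB_eq_cdS_bondCompY)
open B9Eq3104CommutatorSizesDD (C2X_div_bigSide_sq_eq)
open B9Eq3104CommutatorSizes (norm_KhBY_hTY_apply_le)
open B9Eq3104CommutatorSupport (touch_symm touch_src_edgeY levY_src_le_of_KhBY_hTY_ne_zero dist_blkOf_le_one_of_touch' dist_bondT_triangle
  qwt_ne_zero_of_qsK_ne_zero qwt_ne_zero_of_qK_ne_zero levY_src_bounds_of_qwt_ne_zero dist_blkV1_beta_le_of_qwt_ne_zero)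
open B6KLevelCensusIndexV1 (KIdx)
open B6Ineq2142KLevelV1 (β lvl qwt qwt_nonneg)
open B6GlobalChartV1 (PV blkV1)
open B4TorusKernel.MultiPeriod (torusSupNorm)
open B6Geom246MultiLevelBox (bset blkOf)
open B6Geom246MultiLevelTorus (bondT)
open B6MultiLevelBoxOperator (bigSide)
open B6Cover236MultiLevelBlocks (cubes)
open B6Partition118KLevelTorus (abs_hT_le_one)
open B6Partition118KLevelFineSizes (C1F C1F_nonneg)
open B6Partition118KLevelFineMixed (C2X C2X_bounds)
open B6Partition118KLevelTorusBinders (sLipT sLipT_nonneg)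
open B6Prop22KLevelTorusCensusEta (nKT)
open B6IndexBondLayersKLevelV1 (sum_qwt_lvl_le)
open B9Eq3132Ineq2142Covariant (qK_apply)
open B9GeoNormsKLevelV1 (geo9K blkOf_level_le)
open B9GeoLemma21KLevelV1 (one_le_Mh one_le_P)
open Node00.OpsYNablaBridge (chartY bondCompY bondCompY_apply)
open B9Eq39Adjoint (R plaqU)
open B9Eq3104CommutatorSizesCurl (jIns)
open scoped Matrix

variable {𝔸 : Type} [NormedRing 𝔸] [NormedAlgebra ℂ 𝔸] [CompleteSpace 𝔸]
variable {d ℓ : ℕ} {hd : 1 ≤ d + 1} {hL : Odd (ℓ + 1) ∧ 1 < ℓ + 1} {b₀ b₁ : ℝ}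
variable (i : KIdx d ℓ hd hL b₀ b₁)

/-! ## §1 Bookkeeping: sup norms, `|c_f| = L^k`, the two-step stencil, the weight band, `Σ_y |Q*(b,y)|` -/

omit [NormedAlgebra ℂ 𝔸] [CompleteSpace 𝔸] in
/-- `|J| ≥ |J(x)|` for the sup norm of a bond localisation. [cite: Balaban1985BackgroundPropagators, (3.39) p.397 («|A| = max sup»), bookkeeping] -/
theorem abs_le_supNorm_inr (J : FBondY i → ℝ) (x : FBondY i) : |J x| ≤ (geo9K i).supNorm (Sum.inr J) :=
  le_ciSup (f := fun x => |J x|) (Set.finite_range _).bddAbove x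

omit [NormedAlgebra ℂ 𝔸] [CompleteSpace 𝔸] in
/-- `|J| ≥ 0`. [cite: Balaban1985BackgroundPropagators, (3.39) p.397, bookkeeping] -/
theorem supNorm_inr_nonneg (J : FBondY i → ℝ) (x : FBondY i) : 0 ≤ (geo9K i).supNorm (Sum.inr J) :=
  (abs_nonneg _).trans (abs_le_supNorm_inr i J x)

omit [NormedAlgebra ℂ 𝔸] [CompleteSpace 𝔸] in
/-- **`η = |c_f|⁻¹` MEANS `|c_f| = L^k`** (print's units, (2.1) of [4]). [cite: Balaban1984PropagatorsII, (2.1) p.224 («η = L^{−k}»); Balaban1985BackgroundPropagators, p.389] -/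
theorem abs_cf_eq_of_eta (hη : etaS i = |i.cf|⁻¹) : |i.cf| = ((ℓ : ℝ) + 1) ^ i.k := by
  have hk : nKT (toKT i) = (ℓ + 1) ^ i.k := rfl
  unfold etaS at hη
  rw [hk] at hη
  push_cast at hη
  exact (inv_inj.1 hη).symm

omit [NormedAlgebra ℂ 𝔸] [CompleteSpace 𝔸] in
/-- the torus level of a site is at most `k`. [cite: Balaban1984PropagatorsII, (2.1)–(2.4) p.224, bookkeeping] -/
theorem levY_le_k (z : SiteY i) : levY i z ≤ i.k := blkOf_level_le i z

omit [NormedAlgebra ℂ 𝔸] [CompleteSpace 𝔸] in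
/-- hence, at `η = |c_f|⁻¹`, `L^{lev z} ≤ |c_f|` (every length `Lʲη ≤ 1`). [cite: Balaban1984PropagatorsII, (2.1) p.224, bookkeeping] -/
theorem pow_levY_le_abs_cf (hη : etaS i = |i.cf|⁻¹) (z : SiteY i) : ((ℓ : ℝ) + 1) ^ levY i z ≤ |i.cf| := by
  rw [abs_cf_eq_of_eta i hη]
  exact pow_le_pow_right₀ (by linarith [(Nat.cast_nonneg ℓ : (0 : ℝ) ≤ ℓ)]) (levY_le_k i z)

omit [NormedAlgebra ℂ 𝔸] [CompleteSpace 𝔸] in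
/-- ONE lattice step: blocks at torus block distance `≤ 1`, levels up by at most one. [cite: Balaban1984PropagatorsII, (2.2) p.224, (2.46) p.231] -/
theorem step_facts {z w : SiteY i} (h : torusSupNorm (toKT i).NB (z.1 - w.1) ≤ 1) :
    ((bondT i.D).dist (blkOf i.D.toDomains z) (blkOf i.D.toDomains w) : ℝ) ≤ 1 ∧ levY i w ≤ levY i z + 1 :=
  ⟨dist_blkOf_le_one_of_touch' i h, lev_le_succ_of_touch i h⟩

omit [NormedAlgebra ℂ 𝔸] [CompleteSpace 𝔸] in
/-- TWO lattice steps (the stencil of `K(h_□)` around `chart b₋`): blocks at torus block distance `≤ 2`, levels up by at most two.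
[cite: Balaban1984PropagatorsII, (2.2) p.224, (2.46) p.231; Balaban1985BackgroundPropagators, p.414 l.1–3] -/
theorem two_step_facts {z w₁ w : SiteY i} (h₁ : torusSupNorm (toKT i).NB (z.1 - w₁.1) ≤ 1) (h₂ : torusSupNorm (toKT i).NB (w₁.1 - w.1) ≤ 1) :
    ((bondT i.D).dist (blkOf i.D.toDomains z) (blkOf i.D.toDomains w) : ℝ) ≤ 2 ∧ levY i w ≤ levY i z + 2 := by
  obtain ⟨d1, l1⟩ := step_facts i h₁
  obtain ⟨d2, l2⟩ := step_facts i h₂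
  have t := dist_bondT_triangle i (blkOf i.D.toDomains z) (blkOf i.D.toDomains w₁) (blkOf i.D.toDomains w)
  exact ⟨by linarith, by omega⟩

omit [NormedAlgebra ℂ 𝔸] [CompleteSpace 𝔸] in
/-- **THE WEIGHT BAND AS AN UPPER BOUND**: `w_y ≤ b₁·(L^{j(y)})^{d+1}·(c_f∕L^{j(y)})²`. [cite: Balaban1984PropagatorsII, (2.16) p.225, (2.90) p.239] -/
theorem w_le_of_band (y : IBondY i) :
    i.w y ≤ b₁ * ((((ℓ + 1 : ℕ) : ℝ)) ^ lvl i.hN i.D i.hk y) ^ (d + 1) * (i.cf / (((ℓ + 1 : ℕ) : ℝ)) ^ lvl i.hN i.D i.hk y) ^ 2 := by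
  have h := (i.hwb y).2
  have hne : i.cf / (((ℓ + 1 : ℕ) : ℝ)) ^ lvl i.hN i.D i.hk y ≠ 0 := div_ne_zero i.hcf (pow_ne_zero _ (by positivity))
  have hpos : 0 < (i.cf / (((ℓ + 1 : ℕ) : ℝ)) ^ lvl i.hN i.D i.hk y) ^ 2 := by rw [pow_two]; exact mul_self_pos.2 hne
  exact (div_le_iff₀ hpos).1 h

omit [NormedAlgebra ℂ 𝔸] [CompleteSpace 𝔸] in
/-- the band constant is positive (the weights are). [cite: Balaban1984PropagatorsII, (2.16) p.225, bookkeeping] -/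
theorem b1_pos (y : IBondY i) : 0 < b₁ := by
  have h := w_le_of_band i y
  have hw := i.hw y
  have hA : 0 < ((((ℓ + 1 : ℕ) : ℝ)) ^ lvl i.hN i.D i.hk y) ^ (d + 1) * (i.cf / (((ℓ + 1 : ℕ) : ℝ)) ^ lvl i.hN i.D i.hk y) ^ 2 := by
    have hne : i.cf / (((ℓ + 1 : ℕ) : ℝ)) ^ lvl i.hN i.D i.hk y ≠ 0 := div_ne_zero i.hcf (pow_ne_zero _ (by positivity))
    have hpos : 0 < (i.cf / (((ℓ + 1 : ℕ) : ℝ)) ^ lvl i.hN i.D i.hk y) ^ 2 := by rw [pow_two]; exact mul_self_pos.2 hne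
    positivity
  by_contra hb
  push Not at hb
  have : b₁ * ((((ℓ + 1 : ℕ) : ℝ)) ^ lvl i.hN i.D i.hk y) ^ (d + 1) * (i.cf / (((ℓ + 1 : ℕ) : ℝ)) ^ lvl i.hN i.D i.hk y) ^ 2 ≤ 0 := by
    rw [mul_assoc]; exact mul_nonpos_of_nonpos_of_nonneg hb hA.le
  linarith

omit [NormedAlgebra ℂ 𝔸] [CompleteSpace 𝔸] in
/-- ★ **THE COLUMN SUM OF THE BOND AVERAGING: `Σ_y |Q*(b,y)| ≤ 2·(L^{d+1})^{−lev b}`** — only the coarse bonds of levels `lev b` and `lev b + 1` average `b`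
([4] (2.2)–(2.4)), and the weights of one level are a sub-partition of unity bounded by the plateau `L^{−(d+1)J}` (n06-i's `sum_qwt_lvl_le`).
[cite: Balaban1984PropagatorsI, (1.18) p.20; Balaban1984PropagatorsII, (2.3)–(2.4) p.224, (2.20) p.226] -/
theorem sum_abs_qsK_le (b : FBondY i) :
    ∑ y, |qsK i b y| ≤ 2 * ((((ℓ + 1 : ℕ) : ℝ) ^ (d + 1)) ^ levY i (chartY i b.src))⁻¹ := by
  classical
  set J₀ : ℕ := levY i (chartY i b.src) with hJ₀
  have hL1 : (1 : ℝ) ≤ ((ℓ + 1 : ℕ) : ℝ) ^ (d + 1) := one_le_pow₀ (by exact_mod_cast Nat.succ_le_succ (Nat.zero_le ℓ))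
  -- `|Q*(b,y)| = q_y(b)`, split by the two admissible levels
  have hpt : ∀ y : IBondY i, |qsK i b y|
      = (if lvl i.hN i.D i.hk y = J₀ then qwt i.hN i.D i.hk y b else 0) + (if lvl i.hN i.D i.hk y = J₀ + 1 then qwt i.hN i.D i.hk y b else 0) := by
    intro y
    rw [qsK_eq_transpose, Matrix.transpose_apply, qK_apply, abs_of_nonneg (qwt_nonneg _ _ _ _ _)]
    by_cases hq : qwt i.hN i.D i.hk y b = 0
    · rw [hq]; split_ifs <;> simp
    · have hb := levY_src_bounds_of_qwt_ne_zero i hq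
      by_cases h1 : lvl i.hN i.D i.hk y = J₀
      · rw [if_pos h1, if_neg (by omega), add_zero]
      · have h2 : lvl i.hN i.D i.hk y = J₀ + 1 := by omega
        rw [if_neg h1, if_pos h2, zero_add]
  rw [Finset.sum_congr rfl fun y _ => hpt y, Finset.sum_add_distrib, ← Finset.sum_filter, ← Finset.sum_filter]
  have s1 := sum_qwt_lvl_le i J₀ b
  have s2 := sum_qwt_lvl_le i (J₀ + 1) b
  have hmono : (((((ℓ + 1 : ℕ) : ℝ) ^ (d + 1)) ^ (J₀ + 1))⁻¹) ≤ ((((ℓ + 1 : ℕ) : ℝ) ^ (d + 1)) ^ J₀)⁻¹ := by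
    rw [inv_le_inv₀ (by positivity) (by positivity)]
    exact pow_le_pow_right₀ hL1 (Nat.le_succ _)
  linarith

/-! ## §2 The constant, the level bookkeeping, and the bond-sector (3.89) pointwise -/

/-- **THE CONSTANT OF THE BOND-SECTOR (3.89)** before division by `M = L·M_h` (legend in the module docstring; `j` = the level of the cube, entering only
through the displayed holonomy defect `δ_P·Lʲ`). [cite: Balaban1985BackgroundPropagators, (3.89) p.409 («O(M⁻¹)»), p.414 l.1–3] -/
def theta389B (d ℓ : ℕ) (B₀ b₁ δ ρ δP δK δI : ℝ) (j : ℕ) : ℝ :=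
  B₀ * (Real.exp (2 * δ) * ((4 * ρ + 1) * ((d : ℝ) + 1) * (2 * (5 / 8 * C1F d ℓ) * ((ℓ : ℝ) + 1) ^ 4 + (5 / 8) ^ 2 * C2X d ℓ * ((ℓ : ℝ) + 1) ^ 8
        + (5 / 8 * C1F d ℓ) * ((ℓ : ℝ) + 1) ^ 8 * δP * ((ℓ : ℝ) + 1) ^ j)
      + ((d : ℝ) + 1) * (5 / 8 * C1F d ℓ) * ((ℓ : ℝ) + 1) ^ 6 * (4 * δK + 64 * δI))
    + 4 * (sLipT d ℓ * (((ℓ : ℝ) + 1) + 3)) * b₁ * ((ℓ : ℝ) + 1) ^ (d + 1) * Real.exp (δ * (2 * (ℓ : ℝ) + 6)))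

omit [NormedAlgebra ℂ 𝔸] [CompleteSpace 𝔸] in
/-- `θ₃₈₉ᴮ ≥ 0` for non-negative data. [cite: Balaban1985BackgroundPropagators, (3.89) p.409, bookkeeping] -/
theorem theta389B_nonneg (d ℓ : ℕ) {B₀ b₁ ρ δP δK δI : ℝ} (hB₀ : 0 ≤ B₀) (hb₁ : 0 ≤ b₁) (hρ : 0 ≤ ρ) (hδP : 0 ≤ δP) (hδK : 0 ≤ δK)
    (hδI : 0 ≤ δI) (δ : ℝ) (j : ℕ) : 0 ≤ theta389B d ℓ B₀ b₁ δ ρ δP δK δI j := by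
  unfold theta389B
  have := C1F_nonneg d ℓ
  have := (C2X_bounds d ℓ).2.2
  have := sLipT_nonneg d ℓ
  have := Real.exp_pos (2 * δ)
  have := Real.exp_pos (δ * (2 * (ℓ : ℝ) + 6))
  positivity

omit [NormedAlgebra ℂ 𝔸] [CompleteSpace 𝔸] in
/-- **THE LEVEL BOOKKEEPING OF THE BOND-SECTOR (3.89) AS ONE REAL INEQUALITY**: E′₁'s print-shape size, fed with value ∕ gradient entries of sizes
`(L^{lev+2}|c_f|⁻¹)²`, `L^{lev+2}c_f⁻²` (near entries, weight `e₂`) and the averaging product `b₁(L^{lev+1})^{d+1}` against the column sum `2(L^{d+1})^{−lev}`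
(already multiplied out to `L^{d+1}`), totals at most `θ₃₈₉ᴮ∕(L·M_h)` — with `lev ≤ j + 2` and `L^{lev} ≤ |c_f|`, every term is uniform in `j` except `δ_P·Lʲ`.
[cite: Balaban1985BackgroundPropagators, (3.89) p.409 («O(M⁻¹)»), p.414 l.1–3 («O(M⁻¹), or O(M⁻²), if considered on a proper scale»), arithmetic] -/
theorem arith389B {dR L Mh C₁ C₂ s B₀ b₁ cf e₂ e₆ E F ρ δP δK δI X : ℝ} {j lev dd : ℕ} (hd : 0 ≤ dR) (hL1 : 1 ≤ L) (hMh1 : 1 ≤ Mh)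
    (hC₁ : 0 ≤ C₁) (hC₂ : 0 ≤ C₂) (hB₀ : 0 ≤ B₀) (hcf1 : 1 ≤ cf) (he₂ : 0 ≤ e₂) (hE : 0 ≤ E) (hF : 0 ≤ F)
    (hρ : 0 ≤ ρ) (hδP : 0 ≤ δP) (hδK : 0 ≤ δK) (hδI : 0 ≤ δI) (hlev : lev ≤ j + 2) (hΛ : L ^ lev ≤ cf)
    (hX : X ≤ cf * ((dR + 1) * (4 * (cf * ρ * (2 * (5 / 8 * C₁ / (L * Mh) * (L ^ j)⁻¹) * (B₀ * (L ^ (lev + 2) * cf⁻¹) * cf⁻¹ * e₂ * E * F)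
            + ((5 / 8 * C₁ / (L * Mh) * (L ^ j)⁻¹) * δP + (5 / 8) ^ 2 * C₂ / (L * Mh) ^ 2 * ((L ^ j) ^ 2)⁻¹)
              * (B₀ * (L ^ (lev + 2) * cf⁻¹) ^ 2 * e₂ * E * F))
            + (5 / 8 * C₁ / (L * Mh) * (L ^ j)⁻¹) * δK * (B₀ * (L ^ (lev + 2) * cf⁻¹) ^ 2 * e₂ * E * F))))
        + 64 * (dR + 1) * δI * (5 / 8 * C₁ / (L * Mh) * (L ^ j)⁻¹) * (B₀ * (L ^ (lev + 2) * cf⁻¹) ^ 2 * e₂ * E * F)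
        + cf ^ 2 * ((dR + 1) * (2 * (5 / 8 * C₁ / (L * Mh) * (L ^ j)⁻¹) * (B₀ * (L ^ (lev + 2) * cf⁻¹) * cf⁻¹ * e₂ * E * F)
            + ((5 / 8 * C₁ / (L * Mh) * (L ^ j)⁻¹) * δP + (5 / 8) ^ 2 * C₂ / (L * Mh) ^ 2 * ((L ^ j) ^ 2)⁻¹)
              * (B₀ * (L ^ (lev + 2) * cf⁻¹) ^ 2 * e₂ * E * F)))
        + 4 * (s / (L * Mh) * (L + 3)) * (b₁ * B₀ * L ^ dd * e₆ * E * F)) :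
    X ≤ B₀ * (e₂ * ((4 * ρ + 1) * (dR + 1) * (2 * (5 / 8 * C₁) * L ^ 4 + (5 / 8) ^ 2 * C₂ * L ^ 8 + (5 / 8 * C₁) * L ^ 8 * δP * L ^ j)
        + (dR + 1) * (5 / 8 * C₁) * L ^ 6 * (4 * δK + 64 * δI)) + 4 * (s * (L + 3)) * b₁ * L ^ dd * e₆) / (L * Mh) * E * F := by
  have hL0 : 0 < L := lt_of_lt_of_le one_pos hL1
  have hM0 : 0 < Mh := lt_of_lt_of_le one_pos hMh1
  have hLM : 0 < L * Mh := mul_pos hL0 hM0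
  have hLM1 : 1 ≤ L * Mh := by nlinarith
  have hc0 : 0 < cf := lt_of_lt_of_le one_pos hcf1
  have hcne : cf ≠ 0 := hc0.ne'
  have hLne : L ≠ 0 := hL0.ne'
  have hMne : Mh ≠ 0 := hM0.ne'
  have hLj : 0 < L ^ j := pow_pos hL0 _
  have hΛ0 : 0 < L ^ lev := pow_pos hL0 _
  -- abbreviations
  set K₁ : ℝ := 5 / 8 * C₁ / (L * Mh) with hK₁
  set K₂ : ℝ := (5 / 8) ^ 2 * C₂ / (L * Mh) ^ 2 with hK₂
  set W : ℝ := B₀ * e₂ * E * F with hW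
  have hK₁0 : 0 ≤ K₁ := by positivity
  have hK₂0 : 0 ≤ K₂ := by positivity
  have hW0 : 0 ≤ W := by positivity
  -- the `c_f`-algebra: every `c_f` cancels but one `c_f⁻¹` (δ_K) and one `c_f⁻²` (δ_I)
  set Y : ℝ := 2 * (K₁ * (L ^ j)⁻¹) * (W * (L ^ lev * L ^ 2)) + (K₁ * (L ^ j)⁻¹ * δP + K₂ * ((L ^ j) ^ 2)⁻¹) * (W * (L ^ lev * L ^ 2) ^ 2)
    with hY
  have hX' : X ≤ 4 * (dR + 1) * (ρ * Y + K₁ * (L ^ j)⁻¹ * δK * (W * (L ^ lev * L ^ 2) ^ 2) * cf⁻¹)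
      + 64 * (dR + 1) * δI * (K₁ * (L ^ j)⁻¹) * (W * (L ^ lev * L ^ 2) ^ 2) * cf⁻¹ ^ 2 + (dR + 1) * Y
      + 4 * (s / (L * Mh) * (L + 3)) * (b₁ * B₀ * L ^ dd * e₆ * E * F) := by
    refine hX.trans (le_of_eq ?_)
    rw [hY, hW, hK₁, hK₂, pow_add]
    field_simp
  clear hX
  -- the level window `L^lev ≤ L^j·L²` and `L^lev ≤ c_f`, `c_f ≥ 1`
  have hpow : L ^ lev ≤ L ^ j * L ^ 2 := by
    calc L ^ lev ≤ L ^ (j + 2) := pow_le_pow_right₀ hL1 hlev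
      _ = L ^ j * L ^ 2 := pow_add _ _ _
  have A1 : (L ^ j)⁻¹ * L ^ lev ≤ L ^ 2 := by rw [inv_mul_le_iff₀ hLj]; exact hpow
  have A2 : (L ^ j)⁻¹ * (L ^ lev) ^ 2 ≤ L ^ j * L ^ 4 := by
    rw [inv_mul_le_iff₀ hLj]
    calc (L ^ lev) ^ 2 ≤ (L ^ j * L ^ 2) ^ 2 := pow_le_pow_left₀ hΛ0.le hpow 2
      _ = L ^ j * (L ^ j * L ^ 4) := by ring
  have A3 : ((L ^ j) ^ 2)⁻¹ * (L ^ lev) ^ 2 ≤ L ^ 4 := by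
    rw [inv_mul_le_iff₀ (by positivity)]
    calc (L ^ lev) ^ 2 ≤ (L ^ j * L ^ 2) ^ 2 := pow_le_pow_left₀ hΛ0.le hpow 2
      _ = (L ^ j) ^ 2 * L ^ 4 := by ring
  have hΛc : L ^ lev * cf⁻¹ ≤ 1 := by rw [mul_inv_le_iff₀ hc0, one_mul]; exact hΛ
  have hc1' : cf⁻¹ ≤ 1 := inv_le_one_of_one_le₀ hcf1
  have hcinv0 : 0 ≤ cf⁻¹ := inv_nonneg.2 hc0.le
  have A4 : (L ^ j)⁻¹ * (L ^ lev) ^ 2 * cf⁻¹ ≤ L ^ 2 := by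
    calc (L ^ j)⁻¹ * (L ^ lev) ^ 2 * cf⁻¹ = ((L ^ j)⁻¹ * L ^ lev) * (L ^ lev * cf⁻¹) := by ring
      _ ≤ L ^ 2 * 1 := mul_le_mul A1 hΛc (by positivity) (by positivity)
      _ = L ^ 2 := mul_one _
  have A5 : (L ^ j)⁻¹ * (L ^ lev) ^ 2 * cf⁻¹ ^ 2 ≤ L ^ 2 := by
    calc (L ^ j)⁻¹ * (L ^ lev) ^ 2 * cf⁻¹ ^ 2 = ((L ^ j)⁻¹ * (L ^ lev) ^ 2 * cf⁻¹) * cf⁻¹ := by ring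
      _ ≤ L ^ 2 * 1 := mul_le_mul A4 hc1' hcinv0 (by positivity)
      _ = L ^ 2 := mul_one _
  have A6 : ((L * Mh) ^ 2)⁻¹ ≤ (L * Mh)⁻¹ := by
    rw [inv_le_inv₀ (by positivity) hLM, sq]; exact le_mul_of_one_le_left hLM.le hLM1
  have hK₂' : K₂ ≤ (5 / 8) ^ 2 * C₂ / (L * Mh) := by
    rw [hK₂, div_eq_mul_inv, div_eq_mul_inv]; exact mul_le_mul_of_nonneg_left A6 (by positivity)
  -- term bounds
  have t1 : 2 * (K₁ * (L ^ j)⁻¹) * (W * (L ^ lev * L ^ 2)) ≤ 2 * K₁ * L ^ 4 * W := by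
    have e : 2 * (K₁ * (L ^ j)⁻¹) * (W * (L ^ lev * L ^ 2)) = 2 * K₁ * L ^ 2 * W * ((L ^ j)⁻¹ * L ^ lev) := by ring
    rw [e]
    calc 2 * K₁ * L ^ 2 * W * ((L ^ j)⁻¹ * L ^ lev) ≤ 2 * K₁ * L ^ 2 * W * L ^ 2 := mul_le_mul_of_nonneg_left A1 (by positivity)
      _ = 2 * K₁ * L ^ 4 * W := by ring
  have t2 : K₁ * (L ^ j)⁻¹ * δP * (W * (L ^ lev * L ^ 2) ^ 2) ≤ K₁ * L ^ 8 * δP * L ^ j * W := by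
    have e : K₁ * (L ^ j)⁻¹ * δP * (W * (L ^ lev * L ^ 2) ^ 2) = K₁ * δP * L ^ 4 * W * ((L ^ j)⁻¹ * (L ^ lev) ^ 2) := by ring
    rw [e]
    calc K₁ * δP * L ^ 4 * W * ((L ^ j)⁻¹ * (L ^ lev) ^ 2) ≤ K₁ * δP * L ^ 4 * W * (L ^ j * L ^ 4) := mul_le_mul_of_nonneg_left A2 (by positivity)
      _ = K₁ * L ^ 8 * δP * L ^ j * W := by ring
  have t3 : K₂ * ((L ^ j) ^ 2)⁻¹ * (W * (L ^ lev * L ^ 2) ^ 2) ≤ (5 / 8) ^ 2 * C₂ / (L * Mh) * L ^ 8 * W := by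
    have e : K₂ * ((L ^ j) ^ 2)⁻¹ * (W * (L ^ lev * L ^ 2) ^ 2) = K₂ * L ^ 4 * W * (((L ^ j) ^ 2)⁻¹ * (L ^ lev) ^ 2) := by ring
    rw [e]
    calc K₂ * L ^ 4 * W * (((L ^ j) ^ 2)⁻¹ * (L ^ lev) ^ 2) ≤ K₂ * L ^ 4 * W * L ^ 4 := mul_le_mul_of_nonneg_left A3 (by positivity)
      _ = K₂ * (L ^ 8 * W) := by ring
      _ ≤ (5 / 8) ^ 2 * C₂ / (L * Mh) * (L ^ 8 * W) := mul_le_mul_of_nonneg_right hK₂' (by positivity)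
      _ = (5 / 8) ^ 2 * C₂ / (L * Mh) * L ^ 8 * W := by ring
  have t4 : K₁ * (L ^ j)⁻¹ * δK * (W * (L ^ lev * L ^ 2) ^ 2) * cf⁻¹ ≤ K₁ * L ^ 6 * δK * W := by
    have e : K₁ * (L ^ j)⁻¹ * δK * (W * (L ^ lev * L ^ 2) ^ 2) * cf⁻¹ = K₁ * δK * L ^ 4 * W * ((L ^ j)⁻¹ * (L ^ lev) ^ 2 * cf⁻¹) := by ring
    rw [e]
    calc K₁ * δK * L ^ 4 * W * ((L ^ j)⁻¹ * (L ^ lev) ^ 2 * cf⁻¹) ≤ K₁ * δK * L ^ 4 * W * L ^ 2 := mul_le_mul_of_nonneg_left A4 (by positivity)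
      _ = K₁ * L ^ 6 * δK * W := by ring
  have t5 : 64 * (dR + 1) * δI * (K₁ * (L ^ j)⁻¹) * (W * (L ^ lev * L ^ 2) ^ 2) * cf⁻¹ ^ 2 ≤ 64 * (dR + 1) * δI * K₁ * L ^ 6 * W := by
    have e : 64 * (dR + 1) * δI * (K₁ * (L ^ j)⁻¹) * (W * (L ^ lev * L ^ 2) ^ 2) * cf⁻¹ ^ 2
        = 64 * (dR + 1) * δI * K₁ * L ^ 4 * W * ((L ^ j)⁻¹ * (L ^ lev) ^ 2 * cf⁻¹ ^ 2) := by ring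
    rw [e]
    calc 64 * (dR + 1) * δI * K₁ * L ^ 4 * W * ((L ^ j)⁻¹ * (L ^ lev) ^ 2 * cf⁻¹ ^ 2)
        ≤ 64 * (dR + 1) * δI * K₁ * L ^ 4 * W * L ^ 2 := mul_le_mul_of_nonneg_left A5 (by positivity)
      _ = 64 * (dR + 1) * δI * K₁ * L ^ 6 * W := by ring
  have hYb : Y ≤ 2 * K₁ * L ^ 4 * W + (K₁ * L ^ 8 * δP * L ^ j * W + (5 / 8) ^ 2 * C₂ / (L * Mh) * L ^ 8 * W) := by
    have e : Y = 2 * (K₁ * (L ^ j)⁻¹) * (W * (L ^ lev * L ^ 2))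
        + (K₁ * (L ^ j)⁻¹ * δP * (W * (L ^ lev * L ^ 2) ^ 2) + K₂ * ((L ^ j) ^ 2)⁻¹ * (W * (L ^ lev * L ^ 2) ^ 2)) := by rw [hY]; ring
    rw [e]
    exact add_le_add t1 (add_le_add t2 t3)
  have hρY : ρ * Y ≤ ρ * (2 * K₁ * L ^ 4 * W + (K₁ * L ^ 8 * δP * L ^ j * W + (5 / 8) ^ 2 * C₂ / (L * Mh) * L ^ 8 * W)) :=
    mul_le_mul_of_nonneg_left hYb hρ
  have h4 : 4 * (dR + 1) * (ρ * Y + K₁ * (L ^ j)⁻¹ * δK * (W * (L ^ lev * L ^ 2) ^ 2) * cf⁻¹)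
      ≤ 4 * (dR + 1) * (ρ * (2 * K₁ * L ^ 4 * W + (K₁ * L ^ 8 * δP * L ^ j * W + (5 / 8) ^ 2 * C₂ / (L * Mh) * L ^ 8 * W)) + K₁ * L ^ 6 * δK * W) :=
    mul_le_mul_of_nonneg_left (add_le_add hρY t4) (by positivity)
  have h6 : (dR + 1) * Y ≤ (dR + 1) * (2 * K₁ * L ^ 4 * W + (K₁ * L ^ 8 * δP * L ^ j * W + (5 / 8) ^ 2 * C₂ / (L * Mh) * L ^ 8 * W)) :=
    mul_le_mul_of_nonneg_left hYb (by linarith)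
  have hfin : X ≤ 4 * (dR + 1) * (ρ * (2 * K₁ * L ^ 4 * W + (K₁ * L ^ 8 * δP * L ^ j * W + (5 / 8) ^ 2 * C₂ / (L * Mh) * L ^ 8 * W)) + K₁ * L ^ 6 * δK * W)
      + 64 * (dR + 1) * δI * K₁ * L ^ 6 * W
      + (dR + 1) * (2 * K₁ * L ^ 4 * W + (K₁ * L ^ 8 * δP * L ^ j * W + (5 / 8) ^ 2 * C₂ / (L * Mh) * L ^ 8 * W))
      + 4 * (s / (L * Mh) * (L + 3)) * (b₁ * B₀ * L ^ dd * e₆ * E * F) := by linarith [hX', h4, t5, h6]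
  refine hfin.trans (le_of_eq ?_)
  rw [hK₁, hW]
  ring

/-- ★★ **THE BOND-SECTOR (3.89), POINTWISE, AT def-Y's LETTERS** — for ANY bond cube letter `O` at the configuration `U` whose VALUE and GRADIENT entries
obey Thm 3.3's (3.42)₁,₂ with constants `(B₀, δ)` in the invariant-class reading (displayed hypotheses `h342₀`, `h342₁`), at bi-contractive bond variables and
contour transporters, with E′₁'s displayed class constants `δ_P, ρ, δ_K, δ_I`, a corner-free member (`ιB` a section of `β`) with `η = |c_f|⁻¹`:
`‖(K(h_□)(U)(O(h_□Λ)))(b)‖ ≤ θ₃₈₉ᴮ(…; j)∕(L·M_h) · e^{−δ d(y,y′)} · |J|` for `b ∈ Δ(βy)`, `supp J ⊂ Δ(βy′)`, `‖Λ‖ ≤ |J|` — print's «The operator K(h_□)G_□h_□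
satisfies the inequality (3.89)», `M = L·M_h`, uniform in the cube's level in all terms but the (global) holonomy defect `δ_P·Lʲ`.
[cite: Balaban1985BackgroundPropagators, p.414 («satisfies the inequality (3.89)»), (3.89) p.409, Thm 3.3 p.399; Balaban1984PropagatorsII, (2.43)–(2.44) p.230] -/
theorem norm_KhBY_O_hTY_apply_le (c : ↥(cubes i.D.toDomains)) (parB : BondParY 𝔸 i) (U : CfgY 𝔸 i)
    (O : (FBondY i → 𝔸) →ₗ[ℂ] (FBondY i → 𝔸)) {B₀ δ : ℝ} (hB₀ : 0 ≤ B₀) (hδ : 0 ≤ δ)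
    (hη : etaS i = |i.cf|⁻¹) (ιB : BlkY i → IBondY i) (hι : ∀ s, β i.hN i.D i.hk (ιB s) = s)
    (hU : ∀ μ x, ‖(U μ x : 𝔸)‖ ≤ 1 ∧ ‖(((U μ x)⁻¹ : 𝔸ˣ) : 𝔸)‖ ≤ 1)
    (hT : ∀ (y : IBondY i) (f : FBondY i), ‖(qT i parB U y f : 𝔸)‖ ≤ 1 ∧ ‖(((qT i parB U y f)⁻¹ : 𝔸ˣ) : 𝔸)‖ ≤ 1)
    {δP ρ δK δI : ℝ} (hδP : 0 ≤ δP) (hρ : 0 ≤ ρ) (hδK : 0 ≤ δK) (hδI : 0 ≤ δI)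
    (hP : ∀ (μ lam : Fin (d + 1)) (w : SiteY i) (Y : 𝔸), ‖R (plaqU (shiftY i) (UboxY i U) μ lam w) Y - Y‖ ≤ δP * ‖Y‖)
    (hRe : ∀ p : PlaqY i, ‖reHolY i U p‖ ≤ ρ)
    (hKc : ∀ a e (μ : Fin (d + 1)) (x : SiteY i) (Z : 𝔸),
      ‖R (UboxY i U μ ((shiftY i μ).symm x))⁻¹ (jIns i U a e ((shiftY i μ).symm x) (R (UboxY i U μ ((shiftY i μ).symm x)) Z)) - jIns i U a e x Z‖
        ≤ δK * ‖Z‖)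
    (hI : ∀ p : PlaqY i, ‖((i.cf ^ 2 : ℝ) : ℂ) • imHolY i U p‖ ≤ δI)
    (h342₀ : ∀ (J : FBondY i → ℝ) (y y' : IBondY i), (geo9K i).suppIn (Sum.inr J) y' →
      ∀ Λ : FBondY i → 𝔸, (∀ x, ‖Λ x‖ ≤ |J x|) → ∀ x : FBondY i, blkV1 i.hN i.D x = β i.hN i.D i.hk y →
        ‖O Λ x‖ ≤ B₀ * (geo9K i).len y ^ 2 * Real.exp (-(δ * (geo9K i).dist y y')) * (geo9K i).supNorm (Sum.inr J))
    (h342₁ : ∀ (J : FBondY i → ℝ) (y y' : IBondY i), (geo9K i).suppIn (Sum.inr J) y' →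
      ∀ Λ : FBondY i → 𝔸, (∀ x, ‖Λ x‖ ≤ |J x|) → ∀ (x : FBondY i) (ν : Fin (d + 1)), blkV1 i.hN i.D x = β i.hN i.D i.hk y →
        ‖cdB i U ν (O Λ) x‖ ≤ B₀ * (geo9K i).len y * Real.exp (-(δ * (geo9K i).dist y y')) * (geo9K i).supNorm (Sum.inr J))
    (J : FBondY i → ℝ) (y y' : IBondY i) (hs : (geo9K i).suppIn (Sum.inr J) y')
    (Λ : FBondY i → 𝔸) (hΛ : ∀ x, ‖Λ x‖ ≤ |J x|) (b : FBondY i) (hb : blkV1 i.hN i.D b = β i.hN i.D i.hk y) :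
    ‖KhBY i (hTY i c) parB U (O (cutMulY (hBdY i (hTY i c)) Λ)) b‖
      ≤ theta389B d ℓ B₀ b₁ δ ρ δP δK δI c.1.1 / (((ℓ : ℝ) + 1) * i.Mh) * Real.exp (-(δ * (geo9K i).dist y y'))
          * (geo9K i).supNorm (Sum.inr J) := by
  obtain ⟨_, hMh2, _, _⟩ := side_conditions i
  have hL1 : (1 : ℝ) ≤ (ℓ : ℝ) + 1 := by linarith [(Nat.cast_nonneg ℓ : (0 : ℝ) ≤ ℓ)]
  have hL0 : (0 : ℝ) < (ℓ : ℝ) + 1 := by linarith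
  have hMh1 : (1 : ℝ) ≤ i.Mh := by exact_mod_cast (le_trans (by norm_num) hMh2)
  have hb₁ : 0 < b₁ := b1_pos i y
  set E : ℝ := Real.exp (-(δ * (geo9K i).dist y y')) with hEdef
  set S : ℝ := (geo9K i).supNorm (Sum.inr J) with hSdef
  have hE0 : 0 ≤ E := (Real.exp_pos _).le
  have hS0 : 0 ≤ S := supNorm_inr_nonneg i J b
  have hcf : |i.cf| = ((ℓ : ℝ) + 1) ^ i.k := abs_cf_eq_of_eta i hη
  have hcf1 : 1 ≤ |i.cf| := by rw [hcf]; exact one_le_pow₀ hL1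
  have hc0 : 0 < |i.cf| := lt_of_lt_of_le one_pos hcf1
  -- the zero case is trivial
  by_cases h0 : KhBY i (hTY i c) parB U (O (cutMulY (hBdY i (hTY i c)) Λ)) b = 0
  · rw [h0, norm_zero]
    exact mul_nonneg (mul_nonneg (div_nonneg (theta389B_nonneg d ℓ hB₀ hb₁.le hρ hδP hδK hδI δ _) (by positivity)) hE0) hS0
  -- the level window (E′₂a) and `L^{lev b} ≤ |c_f|`
  set S₀ : SiteY i := chartY i b.src with hS₀def
  set lev : ℕ := levY i S₀ with hlevdef
  have hlev : lev ≤ c.1.1 + 2 := levY_src_le_of_KhBY_hTY_ne_zero i c parB U _ b h0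
  have hΛc : ((ℓ : ℝ) + 1) ^ lev ≤ |i.cf| := pow_levY_le_abs_cf i hη S₀
  -- the profile of `h_□Λ`, and the argument `A = O(h_□Λ)`
  set A : FBondY i → 𝔸 := O (cutMulY (hBdY i (hTY i c)) Λ) with hAdef
  have hΛ' : ∀ x, ‖cutMulY (hBdY i (hTY i c)) Λ x‖ ≤ |J x| :=
    norm_cutMulY_le_of_le (fun x => abs_hT_le_one i.D (one_le_Mh i) (one_le_P i) c _) hΛ
  -- lengths: `ℓ(y₁) = L^{lev w}·|c_f|⁻¹` whenever `Δ(w) = β y₁`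
  have hlen : ∀ {w : SiteY i} {y₁ : IBondY i}, blkOf i.D.toDomains w = β i.hN i.D i.hk y₁ →
      (geo9K i).len y₁ = ((ℓ : ℝ) + 1) ^ levY i w * |i.cf|⁻¹ := fun {w y₁} hw => by
    rw [geo9K_len_eq, ← levY_eq_lvl_of_blkOf_eq i hw, div_eq_mul_inv]; push_cast; rfl
  have hbS₀ : blkOf i.D.toDomains S₀ = β i.hN i.D i.hk y := hb
  -- (A) THE VALUE ENTRY AT A BOND OF THE STENCIL (block within `2`, level within `+2`)
  set G₀ : ℝ := B₀ * (((ℓ : ℝ) + 1) ^ (lev + 2) * |i.cf|⁻¹) ^ 2 * Real.exp (2 * δ) * E * S with hG₀def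
  have hG₀0 : 0 ≤ G₀ := by positivity
  have hval : ∀ x : FBondY i, ((bondT i.D).dist (blkOf i.D.toDomains S₀) (blkOf i.D.toDomains (chartY i x.src)) : ℝ) ≤ 2 →
      levY i (chartY i x.src) ≤ lev + 2 → ‖A x‖ ≤ G₀ := by
    intro x hdx hlx
    have hx : blkOf i.D.toDomains (chartY i x.src) = β i.hN i.D i.hk (ιB (blkOf i.D.toDomains (chartY i x.src))) := by rw [hι]
    have h := h342₀ J _ y' hs _ hΛ' x hx
    rw [hlen (w := chartY i x.src) hx] at h
    have hpow : ((ℓ : ℝ) + 1) ^ levY i (chartY i x.src) ≤ ((ℓ : ℝ) + 1) ^ (lev + 2) := pow_le_pow_right₀ hL1 hlx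
    have hdist : (geo9K i).dist y y' ≤ 2 + (geo9K i).dist (ιB (blkOf i.D.toDomains (chartY i x.src))) y' := by
      rw [geo9K_dist_eq, geo9K_dist_eq, ← hbS₀, ← hx]
      have t := dist_bondT_triangle i (blkOf i.D.toDomains S₀) (blkOf i.D.toDomains (chartY i x.src)) (β i.hN i.D i.hk y')
      linarith
    have hexp : Real.exp (-(δ * (geo9K i).dist (ιB (blkOf i.D.toDomains (chartY i x.src))) y')) ≤ Real.exp (2 * δ) * E := by
      rw [hEdef, ← Real.exp_add]
      have := mul_le_mul_of_nonneg_left hdist hδ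
      exact Real.exp_le_exp.2 (by linarith)
    calc ‖A x‖ ≤ B₀ * (((ℓ : ℝ) + 1) ^ levY i (chartY i x.src) * |i.cf|⁻¹) ^ 2
          * Real.exp (-(δ * (geo9K i).dist (ιB (blkOf i.D.toDomains (chartY i x.src))) y')) * S := h
      _ ≤ B₀ * (((ℓ : ℝ) + 1) ^ (lev + 2) * |i.cf|⁻¹) ^ 2 * (Real.exp (2 * δ) * E) * S := by
          refine mul_le_mul_of_nonneg_right ?_ hS0
          exact mul_le_mul (mul_le_mul_of_nonneg_left (pow_le_pow_left₀ (by positivity) (mul_le_mul_of_nonneg_right hpow (by positivity)) 2) hB₀)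
            hexp (Real.exp_pos _).le (by positivity)
      _ = G₀ := by rw [hG₀def]; ring
  -- (B) THE GRADIENT ENTRY AT A BOND OF THE STENCIL
  set G₁ : ℝ := B₀ * (((ℓ : ℝ) + 1) ^ (lev + 2) * |i.cf|⁻¹) * |i.cf|⁻¹ * Real.exp (2 * δ) * E * S with hG₁def
  have hgrad : ∀ (x : FBondY i) (ν : Fin (d + 1)), ((bondT i.D).dist (blkOf i.D.toDomains S₀) (blkOf i.D.toDomains (chartY i x.src)) : ℝ) ≤ 2 →
      levY i (chartY i x.src) ≤ lev + 2 → ‖cdB i U ν A x‖ ≤ |i.cf| * G₁ := by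
    intro x ν hdx hlx
    have hx : blkOf i.D.toDomains (chartY i x.src) = β i.hN i.D i.hk (ιB (blkOf i.D.toDomains (chartY i x.src))) := by rw [hι]
    have h := h342₁ J _ y' hs _ hΛ' x ν hx
    rw [hlen (w := chartY i x.src) hx] at h
    have hpow : ((ℓ : ℝ) + 1) ^ levY i (chartY i x.src) ≤ ((ℓ : ℝ) + 1) ^ (lev + 2) := pow_le_pow_right₀ hL1 hlx
    have hdist : (geo9K i).dist y y' ≤ 2 + (geo9K i).dist (ιB (blkOf i.D.toDomains (chartY i x.src))) y' := by
      rw [geo9K_dist_eq, geo9K_dist_eq, ← hbS₀, ← hx]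
      have t := dist_bondT_triangle i (blkOf i.D.toDomains S₀) (blkOf i.D.toDomains (chartY i x.src)) (β i.hN i.D i.hk y')
      linarith
    have hexp : Real.exp (-(δ * (geo9K i).dist (ιB (blkOf i.D.toDomains (chartY i x.src))) y')) ≤ Real.exp (2 * δ) * E := by
      rw [hEdef, ← Real.exp_add]
      have := mul_le_mul_of_nonneg_left hdist hδ
      exact Real.exp_le_exp.2 (by linarith)
    calc ‖cdB i U ν A x‖ ≤ B₀ * (((ℓ : ℝ) + 1) ^ levY i (chartY i x.src) * |i.cf|⁻¹)
          * Real.exp (-(δ * (geo9K i).dist (ιB (blkOf i.D.toDomains (chartY i x.src))) y')) * S := h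
      _ ≤ B₀ * (((ℓ : ℝ) + 1) ^ (lev + 2) * |i.cf|⁻¹) * (Real.exp (2 * δ) * E) * S := by
          refine mul_le_mul_of_nonneg_right ?_ hS0
          exact mul_le_mul (mul_le_mul_of_nonneg_left (mul_le_mul_of_nonneg_right hpow (by positivity)) hB₀) hexp (Real.exp_pos _).le
            (by positivity)
      _ = |i.cf| * G₁ := by rw [hG₁def]; field_simp
  -- (B′) the same read on the components: `‖∇_{U,ν}A_a(w)‖ ≤ G₁`, `‖A_a(w)‖ ≤ G₀` at a site `w` of the stencil
  have hvalw : ∀ (w : SiteY i) (a : Fin (d + 1)), ((bondT i.D).dist (blkOf i.D.toDomains S₀) (blkOf i.D.toDomains w) : ℝ) ≤ 2 →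
      levY i w ≤ lev + 2 → ‖bondCompY i a A w‖ ≤ G₀ := by
    intro w a hdw hlw
    have h := hval ⟨(chartY i).symm w, a⟩
    have e : chartY i ((⟨(chartY i).symm w, a⟩ : FBondY i).src) = w := Equiv.apply_symm_apply _ _
    rw [e] at h
    rw [bondCompY_apply]
    exact h hdw hlw
  have hgradw : ∀ (w : SiteY i) (a ν : Fin (d + 1)), ((bondT i.D).dist (blkOf i.D.toDomains S₀) (blkOf i.D.toDomains w) : ℝ) ≤ 2 →
      levY i w ≤ lev + 2 → ‖cdS i U ν (bondCompY i a A) w‖ ≤ G₁ := by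
    intro w a ν hdw hlw
    have h := hgrad ⟨(chartY i).symm w, a⟩ ν
    have e : chartY i ((⟨(chartY i).symm w, a⟩ : FBondY i).src) = w := Equiv.apply_symm_apply _ _
    rw [e, cdB_eq_cdS_bondCompY] at h
    have h' := h hdw hlw
    rw [e, norm_smul, Complex.norm_real, Real.norm_eq_abs] at h'
    exact le_of_mul_le_mul_left h' hc0
  -- the sites of E′₁'s local data are within two lattice steps of `chart b₋`
  have hUb : ∀ (μ : Fin (d + 1)) (z : SiteY i), ‖(UboxY i U μ z : 𝔸)‖ ≤ 1 ∧ ‖(((UboxY i U μ z)⁻¹ : 𝔸ˣ) : 𝔸)‖ ≤ 1 := fun μ z => hU μ _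
  have near1 : ∀ μ : Fin (d + 1), ((bondT i.D).dist (blkOf i.D.toDomains S₀) (blkOf i.D.toDomains ((shiftY i μ).symm S₀)) : ℝ) ≤ 2
      ∧ levY i ((shiftY i μ).symm S₀) ≤ lev + 2 := fun μ => by
    obtain ⟨d1, l1⟩ := step_facts i (torusSupNorm_sub_shiftY_le_one i μ S₀).2
    exact ⟨by linarith, by omega⟩
  have near2 : ∀ lam μ : Fin (d + 1), ((bondT i.D).dist (blkOf i.D.toDomains S₀) (blkOf i.D.toDomains (shiftY i lam ((shiftY i μ).symm S₀))) : ℝ) ≤ 2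
      ∧ levY i (shiftY i lam ((shiftY i μ).symm S₀)) ≤ lev + 2 := fun lam μ =>
    two_step_facts i (torusSupNorm_sub_shiftY_le_one i μ S₀).2 (torusSupNorm_sub_shiftY_le_one i lam _).1
  have near2' : ∀ lam μ : Fin (d + 1), ((bondT i.D).dist (blkOf i.D.toDomains S₀) (blkOf i.D.toDomains ((shiftY i μ).symm (shiftY i lam S₀))) : ℝ) ≤ 2
      ∧ levY i ((shiftY i μ).symm (shiftY i lam S₀)) ≤ lev + 2 := fun lam μ =>
    two_step_facts i (torusSupNorm_sub_shiftY_le_one i lam S₀).1 (torusSupNorm_sub_shiftY_le_one i μ _).2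
  have hA₀ : ∀ a lam μ : Fin (d + 1), ‖bondCompY i a A ((shiftY i μ).symm (chartY i b.src))‖ ≤ G₀
      ∧ ‖bondCompY i a A (shiftY i lam ((shiftY i μ).symm (chartY i b.src)))‖ ≤ G₀ := fun a lam μ =>
    ⟨hvalw _ a (near1 μ).1 (near1 μ).2, hvalw _ a (near2 lam μ).1 (near2 lam μ).2⟩
  have hA₀' : ∀ (p : PlaqY i) (m l : Fin 4), edgeY i p m = b → ‖A (edgeY i p l)‖ ≤ G₀ := by
    intro p m l hm
    have t₁ : torusSupNorm (toKT i).NB (S₀.1 - (chartY i p.src).1) ≤ 1 := by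
      rw [hS₀def, ← hm]; exact touch_symm i (touch_src_edgeY i p m)
    obtain ⟨d2, l2⟩ := two_step_facts i t₁ (touch_src_edgeY i p l)
    exact hval (edgeY i p l) d2 l2
  have hA₁ : ∀ a lam μ : Fin (d + 1), ‖cdS i U lam (bondCompY i a A) ((shiftY i μ).symm (chartY i b.src))‖ ≤ G₁
      ∧ ‖cdsS i U μ (bondCompY i a A) (shiftY i lam (chartY i b.src))‖ ≤ G₁ := fun a lam μ =>
    ⟨hgradw _ a lam (near1 μ).1 (near1 μ).2,
      (norm_cdsS_le_norm_cdS_shift i U hUb μ _ _).trans (hgradw _ a μ (near2' lam μ).1 (near2' lam μ).2)⟩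
  -- (C) THE AVERAGING PRODUCT `w_y‖A(f)‖ ≤ P` on the double blocks met
  set P : ℝ := b₁ * B₀ * (((ℓ : ℝ) + 1) ^ (lev + 1)) ^ (d + 1) * Real.exp (δ * (2 * (ℓ : ℝ) + 6)) * E * S with hPdef
  have hAP : ∀ (y₂ : IBondY i) (f : FBondY i), qsK i b y₂ ≠ 0 → qK i y₂ f ≠ 0 → i.w y₂ * ‖A f‖ ≤ P := by
    intro y₂ f hy₂ hf
    have hqb := qwt_ne_zero_of_qsK_ne_zero i hy₂
    have hqf := qwt_ne_zero_of_qK_ne_zero i hf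
    -- levels: `lev f ≤ j₂ ≤ lev b + 1`
    have hj₂ : lvl i.hN i.D i.hk y₂ ≤ lev + 1 := by
      have := (levY_src_bounds_of_qwt_ne_zero i hqb).1
      rw [← hS₀def, ← hlevdef] at this
      omega
    have hlf : levY i (chartY i f.src) ≤ lvl i.hN i.D i.hk y₂ := (levY_src_bounds_of_qwt_ne_zero i hqf).2
    -- the value entry at `f`
    have hx : blkV1 i.hN i.D f = β i.hN i.D i.hk (ιB (blkV1 i.hN i.D f)) := by rw [hι]
    have h := h342₀ J _ y' hs _ hΛ' f hx
    rw [hlen (w := chartY i f.src) hx] at h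
    -- distances: `d(y,y′) ≤ (ℓ+3) + (ℓ+3) + d(ιB Δ(f), y′)`
    have hdist : (geo9K i).dist y y' ≤ (2 * (ℓ : ℝ) + 6) + (geo9K i).dist (ιB (blkV1 i.hN i.D f)) y' := by
      rw [geo9K_dist_eq, geo9K_dist_eq, ← hbS₀, ← hx]
      have d1 : ((bondT i.D).dist (blkV1 i.hN i.D b) (β i.hN i.D i.hk y₂) : ℝ) ≤ (ℓ : ℝ) + 3 := dist_blkV1_beta_le_of_qwt_ne_zero i hqb
      have d2 : ((bondT i.D).dist (blkV1 i.hN i.D f) (β i.hN i.D i.hk y₂) : ℝ) ≤ (ℓ : ℝ) + 3 := dist_blkV1_beta_le_of_qwt_ne_zero i hqf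
      rw [SimpleGraph.dist_comm (u := blkV1 i.hN i.D f)] at d2
      have t1 := dist_bondT_triangle i (blkV1 i.hN i.D b) (β i.hN i.D i.hk y₂) (blkV1 i.hN i.D f)
      have t2 := dist_bondT_triangle i (blkV1 i.hN i.D b) (blkV1 i.hN i.D f) (β i.hN i.D i.hk y')
      change ((bondT i.D).dist (blkV1 i.hN i.D b) (β i.hN i.D i.hk y') : ℝ) ≤ _
      linarith
    have hexp : Real.exp (-(δ * (geo9K i).dist (ιB (blkV1 i.hN i.D f)) y')) ≤ Real.exp (δ * (2 * (ℓ : ℝ) + 6)) * E := by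
      rw [hEdef, ← Real.exp_add]
      have := mul_le_mul_of_nonneg_left hdist hδ
      exact Real.exp_le_exp.2 (by linarith)
    have hAf : ‖A f‖ ≤ B₀ * (((ℓ : ℝ) + 1) ^ lvl i.hN i.D i.hk y₂ * |i.cf|⁻¹) ^ 2 * (Real.exp (δ * (2 * (ℓ : ℝ) + 6)) * E) * S := by
      refine h.trans (mul_le_mul_of_nonneg_right ?_ hS0)
      exact mul_le_mul (mul_le_mul_of_nonneg_left (pow_le_pow_left₀ (by positivity)
        (mul_le_mul_of_nonneg_right (pow_le_pow_right₀ hL1 hlf) (by positivity)) 2) hB₀) hexp (Real.exp_pos _).le (by positivity)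
    -- the weight
    have hw := w_le_of_band i y₂
    have hw0 : 0 ≤ i.w y₂ := (i.hw y₂).le
    have hLc : (((ℓ + 1 : ℕ) : ℝ)) = (ℓ : ℝ) + 1 := by push_cast; ring
    rw [hLc] at hw
    have hpowj : (((ℓ : ℝ) + 1) ^ lvl i.hN i.D i.hk y₂) ^ (d + 1) ≤ (((ℓ : ℝ) + 1) ^ (lev + 1)) ^ (d + 1) :=
      pow_le_pow_left₀ (by positivity) (pow_le_pow_right₀ hL1 hj₂) _
    calc i.w y₂ * ‖A f‖
        ≤ (b₁ * (((ℓ : ℝ) + 1) ^ lvl i.hN i.D i.hk y₂) ^ (d + 1) * (i.cf / ((ℓ : ℝ) + 1) ^ lvl i.hN i.D i.hk y₂) ^ 2)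
            * (B₀ * (((ℓ : ℝ) + 1) ^ lvl i.hN i.D i.hk y₂ * |i.cf|⁻¹) ^ 2 * (Real.exp (δ * (2 * (ℓ : ℝ) + 6)) * E) * S) :=
          mul_le_mul hw hAf (norm_nonneg _) (by positivity)
      _ = b₁ * B₀ * (((ℓ : ℝ) + 1) ^ lvl i.hN i.D i.hk y₂) ^ (d + 1) * Real.exp (δ * (2 * (ℓ : ℝ) + 6)) * E * S
            * ((i.cf / ((ℓ : ℝ) + 1) ^ lvl i.hN i.D i.hk y₂) ^ 2 * (((ℓ : ℝ) + 1) ^ lvl i.hN i.D i.hk y₂ * |i.cf|⁻¹) ^ 2) := by ring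
      _ = b₁ * B₀ * (((ℓ : ℝ) + 1) ^ lvl i.hN i.D i.hk y₂) ^ (d + 1) * Real.exp (δ * (2 * (ℓ : ℝ) + 6)) * E * S := by
          have hne : ((ℓ : ℝ) + 1) ^ lvl i.hN i.D i.hk y₂ ≠ 0 := pow_ne_zero _ hL0.ne'
          have e : (i.cf / ((ℓ : ℝ) + 1) ^ lvl i.hN i.D i.hk y₂) ^ 2 * (((ℓ : ℝ) + 1) ^ lvl i.hN i.D i.hk y₂ * |i.cf|⁻¹) ^ 2 = 1 := by
            rw [← mul_pow, div_mul_eq_mul_div, mul_div_assoc, mul_div_cancel_left₀ _ hne, mul_pow, inv_pow, sq_abs,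
              mul_inv_cancel₀ (pow_ne_zero 2 i.hcf)]
          rw [e, mul_one]
      _ ≤ P := by
          rw [hPdef]
          have : 0 ≤ b₁ * B₀ := by positivity
          have : 0 ≤ Real.exp (δ * (2 * (ℓ : ℝ) + 6)) * E * S := by positivity
          calc b₁ * B₀ * (((ℓ : ℝ) + 1) ^ lvl i.hN i.D i.hk y₂) ^ (d + 1) * Real.exp (δ * (2 * (ℓ : ℝ) + 6)) * E * S
              = b₁ * B₀ * (Real.exp (δ * (2 * (ℓ : ℝ) + 6)) * E * S) * (((ℓ : ℝ) + 1) ^ lvl i.hN i.D i.hk y₂) ^ (d + 1) := by ring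
            _ ≤ b₁ * B₀ * (Real.exp (δ * (2 * (ℓ : ℝ) + 6)) * E * S) * (((ℓ : ℝ) + 1) ^ (lev + 1)) ^ (d + 1) :=
                mul_le_mul_of_nonneg_left hpowj (by positivity)
            _ = _ := by ring
  -- (D) E′₁ at these data, the column sum, and the bookkeeping
  have hmain := norm_KhBY_hTY_apply_le i c parB U hU hT hδP hρ hδK hδI hP hRe hKc hI A b (G₀ := G₀) (G₁ := G₁) (P := P) hG₀0 hA₀ hA₀' hA₁ hAP
  have hθQ : 0 ≤ 2 * (sLipT d ℓ / (((ℓ : ℝ) + 1) * i.Mh) * (((ℓ : ℝ) + 1) + 3)) * P := by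
    have := sLipT_nonneg d ℓ; positivity
  have hcol := sum_abs_qsK_le i b
  have hLc : (((ℓ + 1 : ℕ) : ℝ)) = (ℓ : ℝ) + 1 := by push_cast; ring
  rw [hLc] at hcol
  have hQ : 2 * (sLipT d ℓ / (((ℓ : ℝ) + 1) * i.Mh) * (((ℓ : ℝ) + 1) + 3)) * P * ∑ y₂, |qsK i b y₂|
      ≤ 4 * (sLipT d ℓ / (((ℓ : ℝ) + 1) * i.Mh) * (((ℓ : ℝ) + 1) + 3))
          * (b₁ * B₀ * ((ℓ : ℝ) + 1) ^ (d + 1) * Real.exp (δ * (2 * (ℓ : ℝ) + 6)) * E * S) := by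
    refine (mul_le_mul_of_nonneg_left hcol hθQ).trans (le_of_eq ?_)
    rw [hPdef]
    have hne : (((ℓ : ℝ) + 1) ^ (d + 1)) ^ lev ≠ 0 := by positivity
    have e : (((ℓ : ℝ) + 1) ^ (lev + 1)) ^ (d + 1) * ((((ℓ : ℝ) + 1) ^ (d + 1)) ^ lev)⁻¹ = ((ℓ : ℝ) + 1) ^ (d + 1) := by
      rw [← pow_mul, ← pow_mul, show (lev + 1) * (d + 1) = (d + 1) * lev + (d + 1) by ring, pow_add, mul_comm (((ℓ : ℝ) + 1) ^ ((d + 1) * lev)),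
        mul_assoc, mul_inv_cancel₀ (by rw [pow_mul]; exact hne), mul_one]
    calc 2 * (sLipT d ℓ / (((ℓ : ℝ) + 1) * i.Mh) * (((ℓ : ℝ) + 1) + 3))
          * (b₁ * B₀ * (((ℓ : ℝ) + 1) ^ (lev + 1)) ^ (d + 1) * Real.exp (δ * (2 * (ℓ : ℝ) + 6)) * E * S)
          * (2 * ((((ℓ : ℝ) + 1) ^ (d + 1)) ^ lev)⁻¹)
        = 4 * (sLipT d ℓ / (((ℓ : ℝ) + 1) * i.Mh) * (((ℓ : ℝ) + 1) + 3))
          * (b₁ * B₀ * ((((ℓ : ℝ) + 1) ^ (lev + 1)) ^ (d + 1) * ((((ℓ : ℝ) + 1) ^ (d + 1)) ^ lev)⁻¹) * Real.exp (δ * (2 * (ℓ : ℝ) + 6)) * E * S) := by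
          ring
      _ = _ := by rw [e]
  rw [C1F_div_bigSide_eq i c.1.1, C2X_div_bigSide_sq_eq i c] at hmain
  have hX := hmain.trans (add_le_add le_rfl hQ)
  rw [hG₀def, hG₁def, show i.cf ^ 2 = |i.cf| ^ 2 from (sq_abs i.cf).symm] at hX
  have hfin := arith389B (X := ‖KhBY i (hTY i c) parB U A b‖) (dd := d + 1) (Nat.cast_nonneg d) hL1 hMh1 (C1F_nonneg d ℓ) (C2X_bounds d ℓ).2.2
    hB₀ hcf1 (Real.exp_pos (2 * δ)).le hE0 hS0 hρ hδP hδK hδI hlev hΛc hX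
  unfold theta389B
  exact hfin

end Literature.MathematicalPhysics.QuantumFieldTheory.Balaban1983to89.B9Thm310CommutatorBound389B

end
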